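import Mathlib

/-!
# Border apolarity, crux `ToricFixedPoints` — sequential compactness of the Grassmannian (helper 1)

Route `ValiantsHypothesis/BorderApolarity`, crux item `stmt-ValiantsHypothesis-5779`, line
`bb-cell-state-polytope`, helper file for stub `stub_cellRetraction`: abstract facts about Kuratowski
limits of `r`-planes in a finite-dimensional complex inner product space `E`.

* `cr_exists_orthonormal_tendsto` — from any sequence of `r`-planes `B t` one can extract a
  subsequence `ψ` and orthonormal bases `b t` of `B (ψ t)` converging to an orthonormal family `c`
  (compactness of the unit ball of `Fin r → E`).
* `cr_mem_span_of_tendsto` — if `z t ∈ span (b t)` converge to `zl` and the orthonormal frames `b t`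
  converge to `c`, then `zl ∈ span c` (the coefficients are inner products, hence converge).
* `cellRetraction_li_of_ls` — if all `B t` and `M` have dimension `r` and `M` contains every subsequential limit
  of elements of the `B (φ t)` (clause (Ls)), then every element of `M` is a limit of elements of the
  `B t` (clause (Li)).
* `cr_ls_of_li` — conversely, (Li) and equality of dimensions give (Ls).
-/

open Filter Module
open scoped InnerProductSpace Topology

namespace Summit.ValiantsHypothesis.ValiantsHypothesis.Theorems.BorderApolarityToricFixedPoints

section Abstract

variable {E : Type*} [NormedAddCommGroup E] [InnerProductSpace ℂ E] [FiniteDimensional ℂ E]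

/-- **Sequential compactness of the Grassmannian, via frames.**  From a sequence of `r`-dimensional
subspaces `B t` of a finite-dimensional complex inner product space one can extract a subsequence
`ψ` and orthonormal bases `b t` of `B (ψ t)` which converge, vector by vector, to an orthonormal
family `c` (orthonormal frames live in the compact unit ball of `Fin r → E`, and orthonormality is a
closed condition). [folklore] -/
theorem cr_exists_orthonormal_tendsto (r : ℕ) (B : ℕ → Submodule ℂ E)
    (hd : ∀ t, finrank ℂ (B t) = r) :
    ∃ ψ : ℕ → ℕ, StrictMono ψ ∧ ∃ (b : ℕ → Fin r → E) (c : Fin r → E),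
      (∀ t, Orthonormal ℂ (b t)) ∧ (∀ t i, b t i ∈ B (ψ t)) ∧ Orthonormal ℂ c ∧
        ∀ i, Tendsto (fun t => b t i) atTop (𝓝 (c i)) := by
  classical
  -- orthonormal bases of the `B t`, indexed by `Fin r`
  let ob : ∀ t, OrthonormalBasis (Fin r) ℂ (B t) := fun t =>
    (stdOrthonormalBasis ℂ (B t)).reindex (finCongr (hd t))
  let b₀ : ℕ → Fin r → E := fun t i => (ob t i : E)
  have hb₀ : ∀ t, Orthonormal ℂ (b₀ t) := fun t =>
    ((B t).subtypeₗᵢ.orthonormal_comp_iff).2 (ob t).orthonormal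
  have hb₀B : ∀ t i, b₀ t i ∈ B t := fun t i => (ob t i).2
  -- the frames lie in the compact unit ball of `Fin r → E`
  haveI : ProperSpace E := FiniteDimensional.proper ℂ E
  have hball : ∀ t, b₀ t ∈ Metric.closedBall (0 : Fin r → E) 1 := by
    intro t
    rw [mem_closedBall_zero_iff, pi_norm_le_iff_of_nonneg zero_le_one]
    intro i
    rw [(hb₀ t).1 i]
  obtain ⟨c, -, ψ, hψ, hlim⟩ := (isCompact_closedBall (0 : Fin r → E) 1).tendsto_subseq hball
  have hlim' : ∀ i, Tendsto (fun t => b₀ (ψ t) i) atTop (𝓝 (c i)) := fun i =>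
    (continuous_apply i).continuousAt.tendsto.comp hlim
  refine ⟨ψ, hψ, fun t => b₀ (ψ t), c, fun t => hb₀ (ψ t), fun t i => hb₀B (ψ t) i, ?_, hlim'⟩
  -- orthonormality passes to the limit
  rw [orthonormal_iff_ite]
  intro i j
  have h1 : Tendsto (fun t => ⟪b₀ (ψ t) i, b₀ (ψ t) j⟫_ℂ) atTop (𝓝 ⟪c i, c j⟫_ℂ) :=
    (hlim' i).inner (hlim' j)
  have h2 : (fun t => ⟪b₀ (ψ t) i, b₀ (ψ t) j⟫_ℂ) = fun _ => if i = j then (1 : ℂ) else 0 := by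
    funext t
    exact orthonormal_iff_ite.1 (hb₀ (ψ t)) i j
  rw [h2] at h1
  exact tendsto_nhds_unique h1 tendsto_const_nhds

omit [FiniteDimensional ℂ E] in
/-- **Limits of vectors of converging frames.**  If the orthonormal frames `b t` converge vector by
vector to `c`, and `z t ∈ span (b t)` converge to `zl`, then `zl ∈ span c`: the coefficients of
`z t` are the inner products `⟪b t i, z t⟫`, which converge to `⟪c i, zl⟫`. [folklore] -/
theorem cr_mem_span_of_tendsto {r : ℕ} {b : ℕ → Fin r → E} {c : Fin r → E}
    (hb : ∀ t, Orthonormal ℂ (b t)) (hlim : ∀ i, Tendsto (fun t => b t i) atTop (𝓝 (c i)))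
    {z : ℕ → E} {zl : E} (hz : ∀ t, z t ∈ Submodule.span ℂ (Set.range (b t)))
    (hzlim : Tendsto z atTop (𝓝 zl)) : zl ∈ Submodule.span ℂ (Set.range c) := by
  -- orthonormal expansion of `z t`
  have hexp : ∀ t, ∑ i, ⟪b t i, z t⟫_ℂ • b t i = z t := by
    intro t
    obtain ⟨a, ha⟩ := (Submodule.mem_span_range_iff_exists_fun ℂ).1 (hz t)
    rw [← ha]
    refine Finset.sum_congr rfl fun i _ => ?_
    rw [(hb t).inner_right_fintype]
  have h1 : Tendsto (fun t => ∑ i, ⟪b t i, z t⟫_ℂ • b t i) atTop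
      (𝓝 (∑ i, ⟪c i, zl⟫_ℂ • c i)) :=
    tendsto_finsetSum _ fun i _ => ((hlim i).inner hzlim).smul (hlim i)
  simp only [hexp] at h1
  rw [tendsto_nhds_unique hzlim h1]
  exact Submodule.sum_mem _ fun i _ =>
    Submodule.smul_mem _ _ (Submodule.subset_span (Set.mem_range_self i))

/-- The span of an orthonormal `Fin r`-frame inside an `r`-plane is the whole plane. [folklore] -/
theorem cr_span_eq_of_orthonormal {r : ℕ} {b : Fin r → E} (hb : Orthonormal ℂ b)
    {B : Submodule ℂ E} (hB : finrank ℂ B = r) (hbB : ∀ i, b i ∈ B) :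
    Submodule.span ℂ (Set.range b) = B := by
  refine Submodule.eq_of_le_of_finrank_eq (Submodule.span_le.2 (Set.range_subset_iff.2 hbB)) ?_
  rw [finrank_span_eq_card hb.linearIndependent, Fintype.card_fin, hB]

/-- **(Ls) and equal dimensions give (Li).**  In a finite-dimensional complex inner product space,
let `B t` be `r`-planes and `M` an `r`-plane containing every subsequential limit of sequences
`x_t ∈ B (φ t)`.  Then every `x ∈ M` is the limit of a sequence `x_t ∈ B t`: otherwise
`dist (x, B t) ≥ ε` along a subsequence `φ`; extracting converging orthonormal frames of the
`B (φ (ψ t))`, their limit frame is orthonormal and lies in `M`, hence spans `M` (dimension), so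
`x` is a limit of elements of the `B (φ (ψ t))` — contradiction.  (Registered sub-goal of stub
`stub_cellRetraction`, hence the closed `∀` form.) [folklore] -/
theorem cellRetraction_li_of_ls :
    ∀ {E : Type} [NormedAddCommGroup E] [InnerProductSpace ℂ E] [FiniteDimensional ℂ E]
      (r : ℕ) (B : ℕ → Submodule ℂ E) (M : Submodule ℂ E),
      (∀ t, Module.finrank ℂ ↥(B t) = r) → Module.finrank ℂ ↥M = r →
      (∀ (x : E) (φ : ℕ → ℕ) (xs : ℕ → E), StrictMono φ → (∀ t, xs t ∈ B (φ t)) →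
        Filter.Tendsto xs Filter.atTop (nhds x) → x ∈ M) →
      ∀ x ∈ M, ∃ xs : ℕ → E, (∀ t, xs t ∈ B t) ∧ Filter.Tendsto xs Filter.atTop (nhds x) := by
  intro E _ _ _ r B M hd hM hLs x hx
  -- from every subsequence extract a further one along which `x` is approximable
  have key : ∀ φ : ℕ → ℕ, StrictMono φ → ∃ ψ : ℕ → ℕ, StrictMono ψ ∧ ∃ zs : ℕ → E,
      (∀ t, zs t ∈ B (φ (ψ t))) ∧ Tendsto zs atTop (𝓝 x) := by
    intro φ hφ
    obtain ⟨ψ, hψ, b, c, hb, hbB, hc, hlim⟩ :=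
      cr_exists_orthonormal_tendsto r (fun t => B (φ t)) (fun t => hd (φ t))
    have hcM : ∀ i, c i ∈ M := fun i =>
      hLs (c i) (φ ∘ ψ) (fun t => b t i) (hφ.comp hψ) (fun t => hbB t i) (hlim i)
    have hspan : Submodule.span ℂ (Set.range c) = M := cr_span_eq_of_orthonormal hc hM hcM
    obtain ⟨a, ha⟩ := (Submodule.mem_span_range_iff_exists_fun ℂ).1 (hspan.symm ▸ hx : x ∈ _)
    refine ⟨ψ, hψ, fun t => ∑ i, a i • b t i, fun t => Submodule.sum_mem _ fun i _ =>
      Submodule.smul_mem _ _ (hbB t i), ?_⟩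
    rw [← ha]
    exact tendsto_finsetSum _ fun i _ => (hlim i).const_smul (a i)
  -- hence the distance from `x` to `B t` tends to `0`
  set d : ℕ → ℝ := fun t => Metric.infDist x (B t : Set E) with hd_def
  have hd0 : Tendsto d atTop (𝓝 0) := by
    rw [Metric.tendsto_atTop]
    intro ε hε
    by_contra H
    push Not at H
    have hfreq : ∃ᶠ t in atTop, ε ≤ d t := by
      rw [frequently_atTop]
      intro N
      obtain ⟨n, hn, hεn⟩ := H N
      refine ⟨n, hn, ?_⟩
      rwa [Real.dist_eq, sub_zero, abs_of_nonneg Metric.infDist_nonneg] at hεn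
    obtain ⟨φ, hφ, hφε⟩ := extraction_of_frequently_atTop hfreq
    obtain ⟨ψ, -, zs, hzs, hzlim⟩ := key φ hφ
    have h1 : Tendsto (fun t => dist x (zs t)) atTop (𝓝 0) := by
      have h := (tendsto_iff_dist_tendsto_zero.1 hzlim)
      simpa only [dist_comm] using h
    obtain ⟨T, hT⟩ := (Metric.tendsto_atTop.1 h1) ε hε
    have h2 := hT T le_rfl
    rw [Real.dist_eq, sub_zero, abs_of_nonneg dist_nonneg] at h2
    exact absurd ((hφε (ψ T)).trans (Metric.infDist_le_dist_of_mem (hzs T))) (not_le.2 h2)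
  -- choose near-optimal approximants
  have hne : ∀ t, (B t : Set E).Nonempty := fun t => ⟨0, Submodule.zero_mem _⟩
  have hxs : ∀ t, ∃ y ∈ (B t : Set E), dist x y < d t + 1 / ((t : ℝ) + 1) := fun t =>
    (Metric.infDist_lt_iff (hne t)).1 (lt_add_of_pos_right _ (by positivity))
  choose xs hxsB hxsd using hxs
  refine ⟨xs, hxsB, ?_⟩
  rw [tendsto_iff_dist_tendsto_zero]
  refine squeeze_zero (g := fun t => d t + 1 / ((t : ℝ) + 1)) (fun t => dist_nonneg) (fun t => ?_)
    (by simpa only [add_zero] using hd0.add tendsto_one_div_add_atTop_nhds_zero_nat)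
  rw [dist_comm]
  exact (hxsd t).le

/-- **(Li) and equal dimensions give (Ls).**  In a finite-dimensional complex inner product space,
let `B t` be `r`-planes and `M` an `r`-plane every element of which is a limit of a sequence
`x_t ∈ B t`.  Then `M` contains every subsequential limit `x` of sequences `x_t ∈ B (φ t)`: extract
converging orthonormal frames `b t → c` of the `B (φ (ψ t))`; every element of `M`, being a limit of
elements of `span (b t)`, lies in `span c` (coefficients are inner products), so `M = span c` by
dimension, and likewise `x ∈ span c`. [folklore] -/
theorem cr_ls_of_li (r : ℕ) (B : ℕ → Submodule ℂ E) (M : Submodule ℂ E)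
    (hd : ∀ t, finrank ℂ (B t) = r) (hM : finrank ℂ M = r)
    (hLi : ∀ x ∈ M, ∃ xs : ℕ → E, (∀ t, xs t ∈ B t) ∧ Tendsto xs atTop (𝓝 x)) :
    ∀ (x : E) (φ : ℕ → ℕ) (xs : ℕ → E), StrictMono φ → (∀ t, xs t ∈ B (φ t)) →
      Tendsto xs atTop (𝓝 x) → x ∈ M := by
  intro x φ xs hφ hxs hxlim
  obtain ⟨ψ, hψ, b, c, hb, hbB, hc, hlim⟩ :=
    cr_exists_orthonormal_tendsto r (fun t => B (φ t)) (fun t => hd (φ t))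
  have hspan : ∀ t, Submodule.span ℂ (Set.range (b t)) = B (φ (ψ t)) := fun t =>
    cr_span_eq_of_orthonormal (hb t) (hd _) (hbB t)
  -- `M ≤ span c`, hence equality by dimension
  have hMc : M ≤ Submodule.span ℂ (Set.range c) := by
    intro y hy
    obtain ⟨ys, hysB, hylim⟩ := hLi y hy
    refine cr_mem_span_of_tendsto hb hlim (z := fun t => ys (φ (ψ t))) (fun t => ?_)
      (hylim.comp (hφ.comp hψ).tendsto_atTop)
    rw [hspan t]
    exact hysB _
  have hMeq : M = Submodule.span ℂ (Set.range c) := by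
    refine Submodule.eq_of_le_of_finrank_eq hMc ?_
    rw [hM, finrank_span_eq_card hc.linearIndependent, Fintype.card_fin]
  rw [hMeq]
  refine cr_mem_span_of_tendsto hb hlim (z := fun t => xs (ψ t)) (fun t => ?_)
    (hxlim.comp hψ.tendsto_atTop)
  rw [hspan t]
  exact hxs _

end Abstract

end Summit.ValiantsHypothesis.ValiantsHypothesis.Theorems.BorderApolarityToricFixedPoints
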